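import Literature.Analysis.InnerProduct.LensSpaceIsospectralRigidityPrime
import Literature.Analysis.InnerProduct.LensWeightsEquivalenceRelation
import HarnessLib

/-!
# Isospectral three-dimensional ORBIFOLD lens spaces are isometric: the residue argument when exactly one weight is prime
# to `q` (Bari–Hunsicker 2019, Theorem 3.1, Cases 3 and 4)

Layer `Literature/Analysis/InnerProduct`, namespace `Literature.Analysis.InnerProduct`; lane `lit-hodgefound`, prover seat
`lit-hodgefound-p06`, generation 46, row g46-#5. THEOREMS only (no definition, no instance, no notation, no named fact). The
tree's generating function of `L(q; p₁, p₂) = S³/⟨diag(γ^{p₁}, γ^{p₂})⟩` (`tsum_lensMultiplicity_mul_pow`, Ikeda–Yamamoto's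
Theorem 3.2 (3.8)) is stated and proved for ARBITRARY integer weights `p₁, p₂` — it is the source's Corollary 2.12 for orbifold
lens spaces (weights not prime to `q`: the cyclic group has fixed points on `S³` and the quotient is a good orbifold) — so the
residue computation of `LensSpaceGeneratingFunctionResidues.lean` (Ikeda–Yamamoto §4) runs verbatim for orbifold weights; this
file carries it out and proves Cases 3 and 4 of the source's main three-dimensional theorem.

## Source, verbatim (held text `paper:arxiv-1705.01412`)

N. Bari, E. Hunsicker, *Isospectrality for orbifold lens spaces*, Canad. J. Math. **72** (2020), arXiv:1705.01412. §1:
"**Theorem 1.1.** Two three-dimensional isospectral orbifold lens spaces are isometric." §2.1: "For `n ≤ q₀`, let `p₁, …, p_n`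
be `n` integers. … We define the lens space `L(q : p₁, …, p_n)` as follows: `L(q : p₁, …, p_n) = S^{2n−1}/G`. Note that if
`gcd(p_i, q) = 1 ∀i`, `L(q : p₁, …, p_n)` is a smooth manifold; … To get an orbifold in this setting with non-trivial
singularities, we must have `gcd(p_i, q) > 1` for some `i`. … **Corollary 2.2.** Let `L = L(q : p₁, …, p_n)` and
`L' = L(q : s₁, …, s_n)` be lens spaces. Then `L` is isometric to `L'` if and only if there is a number `l` coprime with `q`
and there are numbers `e_i ∈ {−1, 1}` such that `(p₁, …, p_n)` is a permutation of `(e₁ls₁, …, e_nls_n) (mod q)`. …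
**Corollary 2.12.** Let `L(q : p₁, …, p_n)` be a lens space and `F_q(z : p₁, …, p_n)` the generating function associated to
the spectrum of `L(q : p₁, …, p_n)`. Then, on the domain `{z ∈ ℂ | |z| < 1}`,
`F_q(z : p₁, …, p_n) = (1/q)∑_{l=1}^{q}(1 − z²)/∏_{i=1}^{n}(z − γ^{p_il})(z − γ^{−p_il})`."
§3: "we write the two isospectral lens spaces as `L₁ = L(q : p₁, p₂)` and `L₂ = L(q : s₁, s₂)`. Now there are only five
possibilities: Case 1 Both `L₁` and `L₂` are manifolds. … Case 2 One of the two lens spaces, say `L₁` is a manifold, while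
the other, `L₂` is an orbifold with non-trivial isotropy groups. … Case 3 Both `L₁` and `L₂` are orbifolds with non-trivial
isotropy groups so that exactly one of `p₁` or `p₂` is coprime to `q` and exactly one of `s₁` or `s₂` is coprime to `q`.
Case 4 Both `L₁` and `L₂` are orbifolds with non-trivial isotropy groups, but in one case, say for `L₁`, exactly one of `p₁`
or `p₂` is coprime to `q`, while for the other lens space, `L₂` neither `s₁` nor `s₂` is coprime to `q`. Case 5 None of
`p₁`, `p₂`, `s₁` and `s₂` is coprime to `q`. … **Theorem 3.1.** Given two 3-dimensional lens spaces `L₁ = L(q : p₁, p₂)` and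
`L₂ = L(q : s₁, s₂)`. If `L₁` is isospectral to `L₂`, then the two lens spaces are isometric. Proof. … **Case 3** By
multiplying the entries of `L₁` and `L₂` by appropriate numbers coprime to `q` we can rewrite `L₁ = L(q:1, x)` and
`L₂ = L(q:1, y)`, where `x` and `y` are not coprime to `q`. Let `F₁(z)` [resp. `F₂(z)`] be the generating function associated
to the spectrum of `L₁` [resp. `L₂`]. Let `γ` be a primitive `q`-th root of unity. Now,
`lim_{z→γ}(z − γ)F₁(z) = lim_{z→γ}(−γ/q)∑_{l=1}^{q}(1 − γ^{−1}z)(1 − z²)/((1 − γ^{l}z)(1 − γ^{−l}z)(1 − γ^{xl}z)(1 − γ^{−xl}z))`.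
Each term of the sum vanishes unless `(1 − γ^{−1}z)` cancels one of the four terms in the denominator. This occurs if one of
the following congruences has a solution: (1) `l + 1 ≡ 0 (mod q)`, (2) `−l + 1 ≡ 0 (mod q)`, (3) `xl + 1 ≡ 0 (mod q)`,
(4) `−xl + 1 ≡ 0 (mod q)`. Congruences (3) and (4) have no solution as `x` is not coprime to `q`. The solution to (1) is
`l = q − 1`, and the solution to (2) is `l = 1`. Substituting …, we get
`lim_{z→γ}(z − γ)F₁(z) = −2γ/(q(1 − γ^{−x+1})(1 − γ^{x+1}))`. By the same argument, we get
`lim_{z→γ}(z − γ)F₂(z) = −2γ/(q(1 − γ^{−y+1})(1 − γ^{y+1}))`. Since `lim_{z→γ}(z − γ)F₁(z) = lim_{z→γ}(z − γ)F₂(z)`, we get …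
`⟹ (γ^{−x+1} + γ^{x+1}) = (γ^{−y+1} + γ^{y+1})`. Since `γ ≠ 0`, we get `(γ^{−x} + γ^{x}) = (γ^{−y} + γ^{y})`, … `⟹
(γ^y − γ^x)(1 − γ^{x+y}) = 0`, … `⟹ x ≡ y (mod q)` or `x ≡ −y (mod q)`. Thus, by Corollary 2.2 we get that `L₁` and `L₂` are
isometric. **Case 4** By the same argument as in Case 3, we get `lim_{z→γ}(z − γ)F₁(z) = −2γ/(q(1 − γ^{−x+1})(1 − γ^{x+1}))`.
However, `lim_{z→γ}(z − γ)F₂(z) = 0` because the congruences (1)–(4) in Case 3 become (1′) `s₁l + 1 ≡ 0 (mod q)`, (2′)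
`−s₁l + 1 ≡ 0 (mod q)`, (3′) `s₂l + 1 ≡ 0 (mod q)`, (4′) `−s₂l + 1 ≡ 0 (mod q)`, and these congruences have no solutions
because `s₁` and `s₂` are not coprime to `q`. Thus, in this case `L₁` cannot be isospectral to `L₂`."

## As formalised (`e(t) = e^{2πit/q}`; the pole `γ` of the source is treated at a general root `z₀ = e(−k)`, `k` prime to
## `q`, `q ∤ 2k` — the source's computation is `k = −1`; isospectrality = equality of all `dim E_{n(n+2)} = lensMultiplicity q p₁ p₂ n`)

* The `l`-th term of (3.8) for `L(q; 1, x)`, `x` NOT prime to `q`, multiplied by `1 − e(k)z`, tends to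
  `R_k(x) = 1/((1 − e(k(x−1)))(1 − e(−k(x+1))))` as `z → e(−k)` if `l ≡ ±k` ((1), (2)) and to `0` otherwise ((3), (4):
  `±lx ≡ k` would make `x` a unit mod `q`); `x ≢ ±1` (these are units), so no second factor vanishes and `R_k(x) ≠ 0`. Hence
  **`tendsto_one_sub_exp_mul_tsum_lensMultiplicity_of_not_isCoprime`**: `(1 − e(k)z)F₁(z) → (2/q)R_k(x)` in the disc. For
  `L(q; s₁, s₂)` with `s₁, s₂` NOT prime to `q` no term has a vanishing factor ((1′)–(4′)):
  **`tendsto_one_sub_exp_mul_tsum_lensMultiplicity_of_not_isCoprime_of_not_isCoprime`**, limit `0`.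
* **Case 3**: **`residue_eq_of_lensMultiplicity_eq_of_not_isCoprime`** (`R_k(x) = R_k(y)`),
  **`dvd_mul_sub_or_dvd_mul_add_of_lensMultiplicity_eq_of_not_isCoprime`** (`q ∣ k(x ∓ y)`: with `A = e(k(x−1))`,
  `B = e(−k(x+1))`, `C, D` likewise for `y`, `W = e(−k(x+y))`: `AB = CD = e(−2k)`, so `A + B = C + D`, and `AW = D`, `CW = B`
  give `(A − C)(1 − W) = 0` — the source's `(γ^y − γ^x)(1 − γ^{x+y}) = 0`), and
  **`dvd_sub_or_dvd_add_of_lensMultiplicity_one_eq_of_not_isCoprime`**: `x ≡ ±y (mod q)` for EVERY `q ≥ 1` (`k = 1` for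
  `q ≥ 3`; for `q = 2` both `x, y` are even; `q = 1` is vacuous).
* **Case 4**: **`exists_lensMultiplicity_one_ne_of_not_isCoprime`** (`(2/q)R₁(x) ≠ 0 = ` the other limit; `q = 2` is the
  direct check `dim E₃(L(2;1,0)) = 2 ≠ 4 = dim E₃(L(2;0,0))` by `decide`).
* General weights (the source's "multiplying the entries … by appropriate numbers coprime to `q`" is the tree's
  `lensMultiplicity_eq_one_left`, and `lensMultiplicity_swap`): **`lensWeightsEquivalent_of_lensMultiplicity_eq_of_not_isCoprime`**,
  **`lensWeightsEquivalent_of_lensMultiplicity_eq_of_xor`** (Case 3 ⟹ Ikeda's criterion `LensWeightsEquivalent`, through the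
  tree's `lensWeightsEquivalent_two_iff`), **`exists_lensMultiplicity_ne_of_not_isCoprime`** (Case 4), and the two together:
  **`lensWeightsEquivalent_of_lensMultiplicity_eq_orbifold`** — THEOREM 3.1 for `L₁` with exactly one weight prime to `q` and
  `L₂` with non-trivial isotropy. The tree's `LensWeightsEquivalent q p s` allows any multiplier `l`; when some `p_j` is prime
  to `q` the multiplier is automatically prime to `q` (**`LensWeightsEquivalent.exists_isCoprime`**), so the conclusion is
  the isometry criterion of Corollary 2.2 as printed.
* NOT formalised here: Case 1 (both manifolds — Ikeda–Yamamoto 1979 / Yamamoto 1980; in the tree for `q` a prime power, twice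
  a prime power, `q ≤ 10`, and odd `q` with `(p₁ ± p₂, q) = 1`), Case 2 (manifold versus orbifold: the source invokes [GR],
  Gordon–Rossetti, on singular sets of isospectral good orbifolds with a common cover), Case 5 (no weight prime to `q`:
  Proposition 3.2 and Lemma 3.3 of the source).

## References

* [BariHunsicker2019] N. Bari, E. Hunsicker, *Isospectrality for orbifold lens spaces*, Canad. J. Math. 72 (2020) (arXiv:1705.01412),
  §2.1 (Corollary 2.2, Theorem 2.11, Corollary 2.12), §3 Theorem 3.1, proof, Cases 3 and 4.
* [IkedaYamamoto1979] A. Ikeda, Y. Yamamoto, *On the spectra of 3-dimensional lens spaces*, Osaka J. Math. 16 (1979) 447–469,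
  Theorem 3.2 (3.8), Proposition 4.1, proof of Proposition 4.6 (the residue computation this file adapts).
* [Ikeda1980] A. Ikeda, *On lens spaces which are isospectral but not isometric*, Ann. Sci. ÉNS (4) 13 (1980) 303–315,
  Theorem 2.1 (4) (the criterion `LensWeightsEquivalent`).
-/

noncomputable section

open Finset Filter Topology Complex

namespace Literature.Analysis.InnerProduct

open _root_.Real _root_.Filter _root_.Topology

/-! ### §1 The roots of unity `e(t) = e^{2πit/q}`, the two limit lemmas and the terms `l ≡ ±k` (private copies of the private
§1–§2 helpers of `LensSpaceGeneratingFunctionResidues.lean`, suffix `_o`) -/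

/-- `e(a)·e(b) = e(a + b)`. [folklore] -/
private theorem exp_intCast_mul_exp_intCast_o (q : ℕ) (a b : ℤ) :
    cexp (2 * π * I * a / q) * cexp (2 * π * I * b / q) = cexp (2 * π * I * ((a + b : ℤ) : ℂ) / q) := by
  rw [← Complex.exp_add]
  congr 1
  push_cast
  ring

/-- `e(a) = 1 ↔ q ∣ a`. [folklore] -/
private theorem exp_intCast_eq_one_iff_o {q : ℕ} (hq : q ≠ 0) (a : ℤ) :
    cexp (2 * π * I * a / q) = 1 ↔ (q : ℤ) ∣ a := by
  have hq0 : (q : ℂ) ≠ 0 := Nat.cast_ne_zero.mpr hq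
  have h2 : (2 * π * I : ℂ) ≠ 0 := by simp [Real.pi_ne_zero, I_ne_zero]
  constructor
  · intro h
    obtain ⟨n, hn⟩ := Complex.exp_eq_one_iff.mp h
    have h3 := congrArg (· * (q : ℂ)) hn
    simp only [div_mul_cancel₀ _ hq0] at h3
    have h4 : (2 * π * I) * (a : ℂ) = (2 * π * I) * (n * q) := by linear_combination h3
    have h5 := mul_left_cancel₀ h2 h4
    exact ⟨n, by exact_mod_cast h5.trans (mul_comm _ _)⟩
  · rintro ⟨c, hc⟩
    rw [hc, show (2 * π * I * ((q * c : ℤ) : ℂ) / q) = c * (2 * π * I) by push_cast; field_simp]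
    exact Complex.exp_int_mul_two_pi_mul_I c

/-- `e(a) = 1 ↔ a ≡ 0` in `ℤ/q`. [folklore] -/
private theorem exp_intCast_eq_one_iff_cast_o {q : ℕ} (hq : q ≠ 0) (a : ℤ) :
    cexp (2 * π * I * a / q) = 1 ↔ (a : ZMod q) = 0 := by
  rw [exp_intCast_eq_one_iff_o hq, ZMod.intCast_zmod_eq_zero_iff_dvd]

/-- `e(a) = e(b) ↔ a ≡ b` in `ℤ/q`. [folklore] -/
private theorem exp_intCast_eq_iff_o {q : ℕ} (hq : q ≠ 0) (a b : ℤ) :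
    cexp (2 * π * I * a / q) = cexp (2 * π * I * b / q) ↔ (a : ZMod q) = (b : ZMod q) := by
  have hb : cexp (2 * π * I * b / q) ≠ 0 := Complex.exp_ne_zero _
  rw [← div_eq_one_iff_eq hb, ← Complex.exp_sub, show 2 * π * I * (a : ℂ) / q - 2 * π * I * (b : ℂ) / q =
    2 * π * I * ((a - b : ℤ) : ℂ) / q by push_cast; ring, exp_intCast_eq_one_iff_cast_o hq, Int.cast_sub, sub_eq_zero]

/-- `e(a) = e(b)` when `a ≡ b` in `ℤ/q`. [folklore] -/
private theorem exp_intCast_congr_o {q : ℕ} (hq : q ≠ 0) {a b : ℤ} (h : (a : ZMod q) = (b : ZMod q)) :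
    cexp (2 * π * I * a / q) = cexp (2 * π * I * b / q) :=
  (exp_intCast_eq_iff_o hq a b).mpr h

/-- `|e(a)| = 1`. [folklore] -/
private theorem norm_exp_intCast_o (q : ℕ) (a : ℤ) : ‖cexp (2 * π * I * a / q)‖ = 1 := by
  rw [show (2 * π * I * a / q : ℂ) = ((2 * π * a / q : ℝ) : ℂ) * I by push_cast; ring]
  exact Complex.norm_exp_ofReal_mul_I _

/-- The tree's `e^{2πi·l·p/q}` of (3.8) is `e(lp)`. [folklore] -/
private theorem exp_natCast_mul_intCast_o (q l : ℕ) (p : ℤ) :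
    cexp (2 * π * I * l * p / q) = cexp (2 * π * I * (((l : ℤ) * p : ℤ) : ℂ) / q) := by
  congr 1
  push_cast
  ring

/-- The tree's `e^{−2πi·l·p/q}` of (3.8) is `e(−lp)`. [folklore] -/
private theorem exp_neg_natCast_mul_intCast_o (q l : ℕ) (p : ℤ) :
    cexp (-(2 * π * I * l * p / q)) = cexp (2 * π * I * ((-((l : ℤ) * p) : ℤ) : ℂ) / q) := by
  congr 1
  push_cast
  ring

/-- **No factor vanishes at `z₀`** (a term holomorphic at `z₀`): `(1 − γz)·(1 − z²)/D(z) → 0` as `z → z₀` when `γz₀ = 1`, `D`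
is continuous at `z₀` and `D(z₀) ≠ 0`. [folklore] -/
private theorem tendsto_mul_div_of_ne_zero_o {γ z₀ : ℂ} (hγ : γ * z₀ = 1) {D : ℂ → ℂ} (hD : ContinuousAt D z₀)
    (hD0 : D z₀ ≠ 0) :
    Tendsto (fun z : ℂ ↦ (1 - γ * z) * ((1 - z ^ 2) / D z)) (𝓝[≠] z₀) (𝓝 0) := by
  have h1 : Tendsto (fun z : ℂ ↦ 1 - γ * z) (𝓝 z₀) (𝓝 (1 - γ * z₀)) :=
    tendsto_const_nhds.sub (tendsto_const_nhds.mul tendsto_id)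
  rw [hγ, sub_self] at h1
  have h2 : Tendsto (fun z : ℂ ↦ (1 - z ^ 2) / D z) (𝓝 z₀) (𝓝 ((1 - z₀ ^ 2) / D z₀)) :=
    (tendsto_const_nhds.sub (tendsto_id.pow 2)).div hD.tendsto hD0
  have h3 := h1.mul h2
  rw [zero_mul] at h3
  exact h3.mono_left nhdsWithin_le_nhds

/-- `γz₀ = 1`, `z ≠ z₀ ⇒ 1 − γz ≠ 0`. [folklore] -/
private theorem one_sub_mul_ne_zero_of_ne_o {γ z₀ z : ℂ} (hγ : γ * z₀ = 1) (hz : z ≠ z₀) : 1 - γ * z ≠ 0 := by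
  intro h
  apply hz
  have hγ0 : γ ≠ 0 := by
    rintro rfl
    simp at hγ
  exact mul_left_cancel₀ hγ0 ((sub_eq_zero.mp h).symm.trans hγ.symm)

/-- **Exactly one factor vanishes at `z₀`** (a simple pole of the term): if `D(z) = (1 − γz)R(z)` with `γz₀ = 1`, `R` continuous
at `z₀` and `R(z₀) ≠ 0`, then `(1 − γz)·(1 − z²)/D(z) → (1 − z₀²)/R(z₀)` as `z → z₀`, `z ≠ z₀`. [folklore] -/
private theorem tendsto_mul_div_of_factor_o {γ z₀ : ℂ} (hγ : γ * z₀ = 1) {D R : ℂ → ℂ}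
    (hDR : ∀ z, D z = (1 - γ * z) * R z) (hR : ContinuousAt R z₀) (hR0 : R z₀ ≠ 0) :
    Tendsto (fun z : ℂ ↦ (1 - γ * z) * ((1 - z ^ 2) / D z)) (𝓝[≠] z₀) (𝓝 ((1 - z₀ ^ 2) / R z₀)) := by
  have h2 : Tendsto (fun z : ℂ ↦ (1 - z ^ 2) / R z) (𝓝 z₀) (𝓝 ((1 - z₀ ^ 2) / R z₀)) :=
    (tendsto_const_nhds.sub (tendsto_id.pow 2)).div hR.tendsto hR0
  refine (h2.mono_left nhdsWithin_le_nhds).congr' ?_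
  filter_upwards [self_mem_nhdsWithin, mem_nhdsWithin_of_mem_nhds (hR.eventually_ne hR0)] with z hz hRz
  have hz' := one_sub_mul_ne_zero_of_ne_o hγ hz
  have hz'' : 1 - z * γ ≠ 0 := by rwa [mul_comm] at hz'
  rw [hDR z]
  field_simp

/-- **The term with its vanishing factor in front** (`l ≡ ±k` for the weight `p`, `l ≡ ±kp*` read as the weight `p*`): for
`q ∤ 2k`, `q ∤ k(p−1)`, `q ∤ k(p+1)`,
`(1 − e(k)z)·(1 − z²)/((1 − e(k)z)(1 − e(−k)z)(1 − e(kp)z)(1 − e(−kp)z)) → 1/((1 − e(k(p−1)))(1 − e(−k(p+1))))` as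
`z → e(−k)`. [cite: IkedaYamamoto1979, proof of Proposition 4.6] -/
private theorem tendsto_core_o {q : ℕ} (hq : q ≠ 0) {k p : ℤ} (h2 : ¬ (q : ℤ) ∣ 2 * k) (hm : ¬ (q : ℤ) ∣ k * (p - 1))
    (hp : ¬ (q : ℤ) ∣ k * (p + 1)) :
    Tendsto (fun z : ℂ ↦ (1 - cexp (2 * π * I * k / q) * z) * ((1 - z ^ 2) /
      ((1 - cexp (2 * π * I * k / q) * z) * (1 - cexp (2 * π * I * ((-k : ℤ) : ℂ) / q) * z) *
        ((1 - cexp (2 * π * I * ((k * p : ℤ) : ℂ) / q) * z) * (1 - cexp (2 * π * I * ((-(k * p) : ℤ) : ℂ) / q) * z)))))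
      (𝓝[≠] (cexp (2 * π * I * ((-k : ℤ) : ℂ) / q)))
      (𝓝 (1 / ((1 - cexp (2 * π * I * ((k * (p - 1) : ℤ) : ℂ) / q)) *
        (1 - cexp (2 * π * I * ((-(k * (p + 1)) : ℤ) : ℂ) / q))))) := by
  -- the values at `z₀ = e(−k)`
  have hγ : cexp (2 * π * I * k / q) * cexp (2 * π * I * ((-k : ℤ) : ℂ) / q) = 1 := by
    rw [exp_intCast_mul_exp_intCast_o, show k + -k = 0 by ring, Int.cast_zero, mul_zero, zero_div, Complex.exp_zero]
  have hsq : cexp (2 * π * I * ((-k : ℤ) : ℂ) / q) ^ 2 = cexp (2 * π * I * ((-(2 * k) : ℤ) : ℂ) / q) := by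
    rw [sq, exp_intCast_mul_exp_intCast_o, show -k + -k = -(2 * k) by ring]
  have hv1 : cexp (2 * π * I * ((-k : ℤ) : ℂ) / q) * cexp (2 * π * I * ((-k : ℤ) : ℂ) / q) =
      cexp (2 * π * I * ((-(2 * k) : ℤ) : ℂ) / q) := by rw [← sq, hsq]
  have hv2 : cexp (2 * π * I * ((k * p : ℤ) : ℂ) / q) * cexp (2 * π * I * ((-k : ℤ) : ℂ) / q) =
      cexp (2 * π * I * ((k * (p - 1) : ℤ) : ℂ) / q) := by
    rw [exp_intCast_mul_exp_intCast_o, show k * p + -k = k * (p - 1) by ring]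
  have hv3 : cexp (2 * π * I * ((-(k * p) : ℤ) : ℂ) / q) * cexp (2 * π * I * ((-k : ℤ) : ℂ) / q) =
      cexp (2 * π * I * ((-(k * (p + 1)) : ℤ) : ℂ) / q) := by
    rw [exp_intCast_mul_exp_intCast_o, show -(k * p) + -k = -(k * (p + 1)) by ring]
  -- none of the three remaining factors vanishes at `z₀`
  have hn1 : 1 - cexp (2 * π * I * ((-(2 * k) : ℤ) : ℂ) / q) ≠ 0 := by
    rw [sub_ne_zero, ne_comm, Ne, exp_intCast_eq_one_iff_o hq, dvd_neg]
    exact h2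
  have hn2 : 1 - cexp (2 * π * I * ((k * (p - 1) : ℤ) : ℂ) / q) ≠ 0 := by
    rw [sub_ne_zero, ne_comm, Ne, exp_intCast_eq_one_iff_o hq]
    exact hm
  have hn3 : 1 - cexp (2 * π * I * ((-(k * (p + 1)) : ℤ) : ℂ) / q) ≠ 0 := by
    rw [sub_ne_zero, ne_comm, Ne, exp_intCast_eq_one_iff_o hq, dvd_neg]
    exact hp
  have h := tendsto_mul_div_of_factor_o hγ
    (D := fun z ↦ (1 - cexp (2 * π * I * k / q) * z) * (1 - cexp (2 * π * I * ((-k : ℤ) : ℂ) / q) * z) *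
      ((1 - cexp (2 * π * I * ((k * p : ℤ) : ℂ) / q) * z) * (1 - cexp (2 * π * I * ((-(k * p) : ℤ) : ℂ) / q) * z)))
    (R := fun z ↦ (1 - cexp (2 * π * I * ((-k : ℤ) : ℂ) / q) * z) *
      ((1 - cexp (2 * π * I * ((k * p : ℤ) : ℂ) / q) * z) * (1 - cexp (2 * π * I * ((-(k * p) : ℤ) : ℂ) / q) * z)))
    (fun z ↦ by ring) (by fun_prop) (by
      show (1 - cexp (2 * π * I * ((-k : ℤ) : ℂ) / q) * cexp (2 * π * I * ((-k : ℤ) : ℂ) / q)) *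
        ((1 - cexp (2 * π * I * ((k * p : ℤ) : ℂ) / q) * cexp (2 * π * I * ((-k : ℤ) : ℂ) / q)) *
          (1 - cexp (2 * π * I * ((-(k * p) : ℤ) : ℂ) / q) * cexp (2 * π * I * ((-k : ℤ) : ℂ) / q))) ≠ 0
      rw [hv1, hv2, hv3]
      exact mul_ne_zero hn1 (mul_ne_zero hn2 hn3))
  have hval : (1 - cexp (2 * π * I * ((-k : ℤ) : ℂ) / q) ^ 2) /
      ((1 - cexp (2 * π * I * ((-k : ℤ) : ℂ) / q) * cexp (2 * π * I * ((-k : ℤ) : ℂ) / q)) *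
        ((1 - cexp (2 * π * I * ((k * p : ℤ) : ℂ) / q) * cexp (2 * π * I * ((-k : ℤ) : ℂ) / q)) *
          (1 - cexp (2 * π * I * ((-(k * p) : ℤ) : ℂ) / q) * cexp (2 * π * I * ((-k : ℤ) : ℂ) / q)))) =
      1 / ((1 - cexp (2 * π * I * ((k * (p - 1) : ℤ) : ℂ) / q)) *
        (1 - cexp (2 * π * I * ((-(k * (p + 1)) : ℤ) : ℂ) / q))) := by
    rw [hsq, hv1, hv2, hv3]
    field_simp
  rw [hval] at h
  exact h

/-- `∑_{x ∈ ℤ/q} F(x̃) = ∑_{l < q} F(l)` through the representatives `x̃ ∈ [0, q)`. [folklore] -/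
private theorem sum_zmod_val_eq_sum_range_o {M : Type*} [AddCommMonoid M] {q : ℕ} [NeZero q] (F : ℕ → M) :
    ∑ x : ZMod q, F x.val = ∑ l ∈ range q, F l := by
  refine Finset.sum_nbij ZMod.val (fun x _ ↦ mem_range.2 (ZMod.val_lt x)) ?_ ?_ (fun _ _ ↦ rfl)
  · exact fun x _ y _ h ↦ ZMod.val_injective q h
  · intro n hn
    exact ⟨(n : ZMod q), by simp, ZMod.val_cast_of_lt (mem_range.1 hn)⟩

/-- The tree's `e^{±2πi·l·p/q}` of (3.8) as `e(t)`, `e(−t)` whenever `lp ≡ t (mod q)`. [folklore] -/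
private theorem exp_natCast_mul_eq_o {q : ℕ} (hq : q ≠ 0) {l : ℕ} {p t : ℤ} (h : (l : ZMod q) * (p : ZMod q) = (t : ZMod q)) :
    cexp (2 * π * I * l * p / q) = cexp (2 * π * I * t / q) ∧
      cexp (-(2 * π * I * l * p / q)) = cexp (2 * π * I * ((-t : ℤ) : ℂ) / q) := by
  have h' : (((l : ℤ) * p : ℤ) : ZMod q) = (t : ZMod q) := by
    rw [Int.cast_mul, Int.cast_natCast, h]
  refine ⟨?_, ?_⟩
  · rw [exp_natCast_mul_intCast_o]
    exact exp_intCast_congr_o hq h'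
  · rw [exp_neg_natCast_mul_intCast_o]
    exact exp_intCast_congr_o hq (by rw [Int.cast_neg, Int.cast_neg, h'])

/-- `e^{2πi·l·p/q}·e(−k) = 1 ↔ lp ≡ k` and `e^{−2πi·l·p/q}·e(−k) = 1 ↔ −lp ≡ k (mod q)`: which factors of the `l`-th term vanish
at `z₀ = e(−k)`. [folklore] -/
private theorem exp_natCast_mul_mul_eq_one_iff_o {q : ℕ} (hq : q ≠ 0) (l : ℕ) (p k : ℤ) :
    (cexp (2 * π * I * l * p / q) * cexp (2 * π * I * ((-k : ℤ) : ℂ) / q) = 1 ↔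
      (l : ZMod q) * (p : ZMod q) = (k : ZMod q)) ∧
    (cexp (-(2 * π * I * l * p / q)) * cexp (2 * π * I * ((-k : ℤ) : ℂ) / q) = 1 ↔
      -((l : ZMod q) * (p : ZMod q)) = (k : ZMod q)) := by
  refine ⟨?_, ?_⟩
  · rw [exp_natCast_mul_intCast_o, exp_intCast_mul_exp_intCast_o, exp_intCast_eq_one_iff_cast_o hq]
    push_cast
    rw [← sub_eq_add_neg, sub_eq_zero]
  · rw [exp_neg_natCast_mul_intCast_o, exp_intCast_mul_exp_intCast_o, exp_intCast_eq_one_iff_cast_o hq]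
    push_cast
    rw [← sub_eq_add_neg, sub_eq_zero]

/-- **Case `l ≡ k`**: the term is `T(z)` of `tendsto_core_o`; limit `R(p)`. [cite: IkedaYamamoto1979, proof of Proposition 4.6] -/
private theorem tendsto_term_pos_o {q : ℕ} (hq : q ≠ 0) {k p : ℤ} (h2 : ¬ (q : ℤ) ∣ 2 * k) (hm : ¬ (q : ℤ) ∣ k * (p - 1))
    (hp : ¬ (q : ℤ) ∣ k * (p + 1)) {l : ℕ} (hl : (l : ZMod q) = (k : ZMod q)) :
    Tendsto (fun z : ℂ ↦ (1 - cexp (2 * π * I * k / q) * z) * ((1 - z ^ 2) /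
      ((1 - cexp (2 * π * I * l * ((1 : ℤ) : ℂ) / q) * z) * (1 - cexp (-(2 * π * I * l * ((1 : ℤ) : ℂ) / q)) * z) *
        ((1 - cexp (2 * π * I * l * (p : ℂ) / q) * z) * (1 - cexp (-(2 * π * I * l * (p : ℂ) / q)) * z)))))
      (𝓝[≠] (cexp (2 * π * I * ((-k : ℤ) : ℂ) / q)))
      (𝓝 (1 / ((1 - cexp (2 * π * I * ((k * (p - 1) : ℤ) : ℂ) / q)) *
        (1 - cexp (2 * π * I * ((-(k * (p + 1)) : ℤ) : ℂ) / q))))) := by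
  have h1 : (l : ZMod q) * ((1 : ℤ) : ZMod q) = (k : ZMod q) := by rw [hl]; push_cast; ring
  have h3 : (l : ZMod q) * (p : ZMod q) = ((k * p : ℤ) : ZMod q) := by rw [hl]; push_cast; ring
  obtain ⟨e1, e2⟩ := exp_natCast_mul_eq_o hq h1
  obtain ⟨e3, e4⟩ := exp_natCast_mul_eq_o hq h3
  simp only [e1, e2, e3, e4]
  exact tendsto_core_o hq h2 hm hp

/-- **Case `l ≡ −k`**: the same function of `z` (the factors come in the pairs `e(±l)`, `e(±lp)`); limit `R(p)`.
[cite: IkedaYamamoto1979, proof of Proposition 4.6] -/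
private theorem tendsto_term_neg_o {q : ℕ} (hq : q ≠ 0) {k p : ℤ} (h2 : ¬ (q : ℤ) ∣ 2 * k) (hm : ¬ (q : ℤ) ∣ k * (p - 1))
    (hp : ¬ (q : ℤ) ∣ k * (p + 1)) {l : ℕ} (hl : (l : ZMod q) = -(k : ZMod q)) :
    Tendsto (fun z : ℂ ↦ (1 - cexp (2 * π * I * k / q) * z) * ((1 - z ^ 2) /
      ((1 - cexp (2 * π * I * l * ((1 : ℤ) : ℂ) / q) * z) * (1 - cexp (-(2 * π * I * l * ((1 : ℤ) : ℂ) / q)) * z) *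
        ((1 - cexp (2 * π * I * l * (p : ℂ) / q) * z) * (1 - cexp (-(2 * π * I * l * (p : ℂ) / q)) * z)))))
      (𝓝[≠] (cexp (2 * π * I * ((-k : ℤ) : ℂ) / q)))
      (𝓝 (1 / ((1 - cexp (2 * π * I * ((k * (p - 1) : ℤ) : ℂ) / q)) *
        (1 - cexp (2 * π * I * ((-(k * (p + 1)) : ℤ) : ℂ) / q))))) := by
  have h1 : (l : ZMod q) * ((1 : ℤ) : ZMod q) = ((-k : ℤ) : ZMod q) := by rw [hl]; push_cast; ring
  have h3 : (l : ZMod q) * (p : ZMod q) = ((-(k * p) : ℤ) : ZMod q) := by rw [hl]; push_cast; ring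
  obtain ⟨e1, e2⟩ := exp_natCast_mul_eq_o hq h1
  obtain ⟨e3, e4⟩ := exp_natCast_mul_eq_o hq h3
  simp only [e1, e2, e3, e4, neg_neg]
  refine ((tendsto_core_o hq h2 hm hp).congr fun z ↦ ?_)
  ring

/-- `𝓝[ball 0 1] z₀ ≤ 𝓝[≠] z₀` and `𝓝[ball 0 1] z₀` is nontrivial, for `|z₀| = 1`. [folklore] -/
private theorem nhdsWithin_ball_le_and_neBot_o {z₀ : ℂ} (hz₀ : ‖z₀‖ = 1) :
    𝓝[Metric.ball (0 : ℂ) 1] z₀ ≤ 𝓝[≠] z₀ ∧ (𝓝[Metric.ball (0 : ℂ) 1] z₀).NeBot := by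
  refine ⟨nhdsWithin_mono _ fun z hz (h1 : z = z₀) ↦ ?_, mem_closure_iff_nhdsWithin_neBot.mp ?_⟩
  · rw [h1, mem_ball_zero_iff, hz₀] at hz
    exact lt_irrefl _ hz
  · rw [closure_ball (0 : ℂ) one_ne_zero, Metric.mem_closedBall, dist_zero_right, hz₀]
/-- `x` is prime to `q` iff `x` is a unit of `ℤ/q`. [folklore] -/
private theorem isUnit_intCast_iff_o {q : ℕ} (x : ℤ) : IsUnit (x : ZMod q) ↔ IsCoprime x q := by
  rw [ZMod.coe_int_isUnit_iff_isCoprime, isCoprime_comm]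

/-! ### §2 The terms of (3.8) = [BariHunsicker2019, Corollary 2.12] for ORBIFOLD weights at `z₀ = e(−k)`, `k` prime to `q` -/

/-- **"Congruences (3) and (4) have no solution as `x` is not coprime to `q`"**: for `k` prime to `q` and `s` NOT prime to
`q`, `ls ≢ k` and `−ls ≢ k (mod q)` for every `l`. [cite: BariHunsicker2019, proof of Theorem 3.1, Case 3] -/
private theorem natCast_mul_ne_o {q : ℕ} {k s : ℤ} (hk : IsCoprime k q) (hs : ¬ IsCoprime s q) (l : ℕ) :
    (l : ZMod q) * (s : ZMod q) ≠ (k : ZMod q) ∧ -((l : ZMod q) * (s : ZMod q)) ≠ (k : ZMod q) := by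
  have hk' : IsUnit (k : ZMod q) := (isUnit_intCast_iff_o k).mpr hk
  have hs' : ¬ IsUnit (s : ZMod q) := fun h ↦ hs ((isUnit_intCast_iff_o s).mp h)
  refine ⟨fun h ↦ hs' ?_, fun h ↦ hs' ?_⟩
  · have h' : IsUnit ((l : ZMod q) * (s : ZMod q)) := by rw [h]; exact hk'
    exact isUnit_of_mul_isUnit_right h'
  · have h' : IsUnit ((l : ZMod q) * (s : ZMod q)) := by rw [← IsUnit.neg_iff, h]; exact hk'
    exact isUnit_of_mul_isUnit_right h'

/-- For `k` prime to `q` and `x` NOT prime to `q`: `q ∤ k(x − 1)` and `q ∤ k(x + 1)` (`x ≢ ±1`, as `±1` are prime to `q`) —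
the factors `1 − γ^{∓x+1}` of the residue are nonzero. [cite: BariHunsicker2019, proof of Theorem 3.1, Case 3] -/
private theorem not_dvd_mul_sub_one_o {q : ℕ} {k x : ℤ} (hk : IsCoprime k q) (hx : ¬ IsCoprime x q) :
    ¬ (q : ℤ) ∣ k * (x - 1) ∧ ¬ (q : ℤ) ∣ k * (x + 1) := by
  have hk' : IsUnit (k : ZMod q) := (isUnit_intCast_iff_o k).mpr hk
  have hx' : ¬ IsUnit (x : ZMod q) := fun h ↦ hx ((isUnit_intCast_iff_o x).mp h)
  refine ⟨fun h ↦ hx' ?_, fun h ↦ hx' ?_⟩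
  · have h1 : (k : ZMod q) * ((x : ZMod q) - 1) = 0 := by
      have e := (ZMod.intCast_zmod_eq_zero_iff_dvd (k * (x - 1)) q).mpr h
      push_cast at e
      exact e
    rw [sub_eq_zero.mp (hk'.mul_right_eq_zero.mp h1)]
    exact isUnit_one
  · have h1 : (k : ZMod q) * ((x : ZMod q) + 1) = 0 := by
      have e := (ZMod.intCast_zmod_eq_zero_iff_dvd (k * (x + 1)) q).mpr h
      push_cast at e
      exact e
    rw [eq_neg_of_add_eq_zero_left (hk'.mul_right_eq_zero.mp h1)]
    exact isUnit_one.neg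

/-- **A term of (3.8) with NO vanishing factor at `z₀ = e(−k)`** — general weights `(s₁, s₂)`: if `ls₁ ≢ ±k` and `ls₂ ≢ ±k` then
`(1 − e(k)z)·(1 − z²)/((1 − e(ls₁)z)(1 − e(−ls₁)z)(1 − e(ls₂)z)(1 − e(−ls₂)z)) → 0` ("Each term of the sum vanishes unless
`(1 − γ^{−1}z)` cancels one of the four terms in the denominator"). [cite: BariHunsicker2019, proof of Theorem 3.1, Case 3] -/
private theorem tendsto_term_zero_o {q : ℕ} (hq : q ≠ 0) {k s₁ s₂ : ℤ} {l : ℕ}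
    (hA : (l : ZMod q) * (s₁ : ZMod q) ≠ (k : ZMod q)) (hB : -((l : ZMod q) * (s₁ : ZMod q)) ≠ (k : ZMod q))
    (hC : (l : ZMod q) * (s₂ : ZMod q) ≠ (k : ZMod q)) (hD : -((l : ZMod q) * (s₂ : ZMod q)) ≠ (k : ZMod q)) :
    Tendsto (fun z : ℂ ↦ (1 - cexp (2 * π * I * k / q) * z) * ((1 - z ^ 2) /
      ((1 - cexp (2 * π * I * l * (s₁ : ℂ) / q) * z) * (1 - cexp (-(2 * π * I * l * (s₁ : ℂ) / q)) * z) *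
        ((1 - cexp (2 * π * I * l * (s₂ : ℂ) / q) * z) * (1 - cexp (-(2 * π * I * l * (s₂ : ℂ) / q)) * z)))))
      (𝓝[≠] (cexp (2 * π * I * ((-k : ℤ) : ℂ) / q))) (𝓝 0) := by
  have hγ : cexp (2 * π * I * k / q) * cexp (2 * π * I * ((-k : ℤ) : ℂ) / q) = 1 := by
    rw [exp_intCast_mul_exp_intCast_o, show k + -k = 0 by ring, Int.cast_zero, mul_zero, zero_div, Complex.exp_zero]
  obtain ⟨i1, i2⟩ := exp_natCast_mul_mul_eq_one_iff_o hq l s₁ k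
  obtain ⟨i3, i4⟩ := exp_natCast_mul_mul_eq_one_iff_o hq l s₂ k
  have f1 : 1 - cexp (2 * π * I * l * (s₁ : ℂ) / q) * cexp (2 * π * I * ((-k : ℤ) : ℂ) / q) ≠ 0 := by
    rw [sub_ne_zero, ne_comm, Ne, i1]
    exact hA
  have f2 : 1 - cexp (-(2 * π * I * l * (s₁ : ℂ) / q)) * cexp (2 * π * I * ((-k : ℤ) : ℂ) / q) ≠ 0 := by
    rw [sub_ne_zero, ne_comm, Ne, i2]
    exact hB
  have f3 : 1 - cexp (2 * π * I * l * (s₂ : ℂ) / q) * cexp (2 * π * I * ((-k : ℤ) : ℂ) / q) ≠ 0 := by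
    rw [sub_ne_zero, ne_comm, Ne, i3]
    exact hC
  have f4 : 1 - cexp (-(2 * π * I * l * (s₂ : ℂ) / q)) * cexp (2 * π * I * ((-k : ℤ) : ℂ) / q) ≠ 0 := by
    rw [sub_ne_zero, ne_comm, Ne, i4]
    exact hD
  exact tendsto_mul_div_of_ne_zero_o hγ (by fun_prop) (mul_ne_zero (mul_ne_zero f1 f2) (mul_ne_zero f3 f4))

/-- **The `l`-th term of (3.8) for the orbifold lens space `L(q; 1, x)` (`x` NOT prime to `q`), multiplied by `1 − e(k)z`, as
`z → e(−k)`, `k` prime to `q`, `q ∤ 2k`**: limit `R_k(x) = 1/((1 − e(k(x−1)))(1 − e(−k(x+1))))` if `l ≡ ±k` (congruences (1),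
(2)) and `0` otherwise — congruences (3), (4) `±xl ≡ k` "have no solution as `x` is not coprime to `q`".
[cite: BariHunsicker2019, proof of Theorem 3.1, Case 3] [cite: IkedaYamamoto1979, proof of Proposition 4.6] -/
private theorem tendsto_term_o {q : ℕ} (hq : q ≠ 0) {k x : ℤ} (hk : IsCoprime k q) (hx : ¬ IsCoprime x q)
    (h2 : ¬ (q : ℤ) ∣ 2 * k) (l : ℕ) :
    Tendsto (fun z : ℂ ↦ (1 - cexp (2 * π * I * k / q) * z) * ((1 - z ^ 2) /
      ((1 - cexp (2 * π * I * l * ((1 : ℤ) : ℂ) / q) * z) * (1 - cexp (-(2 * π * I * l * ((1 : ℤ) : ℂ) / q)) * z) *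
        ((1 - cexp (2 * π * I * l * (x : ℂ) / q) * z) * (1 - cexp (-(2 * π * I * l * (x : ℂ) / q)) * z)))))
      (𝓝[≠] (cexp (2 * π * I * ((-k : ℤ) : ℂ) / q)))
      (𝓝 (if (l : ZMod q) = (k : ZMod q) ∨ (l : ZMod q) = -(k : ZMod q) then
          1 / ((1 - cexp (2 * π * I * ((k * (x - 1) : ℤ) : ℂ) / q)) *
            (1 - cexp (2 * π * I * ((-(k * (x + 1)) : ℤ) : ℂ) / q)))
        else 0)) := by
  obtain ⟨hm, hp⟩ := not_dvd_mul_sub_one_o hk hx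
  by_cases hA : (l : ZMod q) = (k : ZMod q)
  · rw [if_pos (Or.inl hA)]
    exact tendsto_term_pos_o hq h2 hm hp hA
  by_cases hB : (l : ZMod q) = -(k : ZMod q)
  · rw [if_pos (Or.inr hB)]
    exact tendsto_term_neg_o hq h2 hm hp hB
  rw [if_neg (not_or.mpr ⟨hA, hB⟩)]
  obtain ⟨hC, hD⟩ := natCast_mul_ne_o hk hx l
  refine tendsto_term_zero_o hq ?_ ?_ hC hD
  · rwa [Int.cast_one, mul_one]
  · rw [Int.cast_one, mul_one]
    exact fun h ↦ hB (neg_eq_iff_eq_neg.mp h)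

/-- **Exactly two terms contribute**: summing the limits of `tendsto_term_o` over `l < q` gives `2R_k(x)` ("The solution to (1) is
`l = q − 1`, and the solution to (2) is `l = 1`"; the classes `±k` are distinct as `q ∤ 2k`). [cite: BariHunsicker2019, proof of
Theorem 3.1, Case 3] -/
private theorem sum_range_ite_eq_o {q : ℕ} [NeZero q] {k : ℤ} (h2 : ¬ (q : ℤ) ∣ 2 * k) (X : ℂ) :
    ∑ l ∈ range q, (if (l : ZMod q) = (k : ZMod q) ∨ (l : ZMod q) = -(k : ZMod q) then X else 0) = 2 * X := by
  have d1 : (k : ZMod q) ≠ -(k : ZMod q) := by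
    intro h
    apply h2
    rw [← ZMod.intCast_zmod_eq_zero_iff_dvd]
    push_cast
    linear_combination h
  have hre := sum_zmod_val_eq_sum_range_o (q := q) (fun l : ℕ ↦
    (if (l : ZMod q) = (k : ZMod q) ∨ (l : ZMod q) = -(k : ZMod q) then X else 0))
  simp only [ZMod.natCast_zmod_val] at hre
  rw [← hre]
  have hpt : ∀ y : ZMod q, (if y = (k : ZMod q) ∨ y = -(k : ZMod q) then X else 0) =
      (if y = (k : ZMod q) then X else 0) + (if y = -(k : ZMod q) then X else 0) := by
    intro y
    by_cases h1 : y = (k : ZMod q)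
    · rw [if_pos (Or.inl h1), if_pos h1, if_neg (fun h ↦ d1 (h1.symm.trans h))]
      ring
    by_cases h1' : y = -(k : ZMod q)
    · rw [if_pos (Or.inr h1'), if_neg h1, if_pos h1']
      ring
    rw [if_neg (not_or.mpr ⟨h1, h1'⟩), if_neg h1, if_neg h1']
    ring
  rw [Finset.sum_congr rfl fun y _ ↦ hpt y]
  simp only [Finset.sum_add_distrib, Finset.sum_ite_eq', Finset.mem_univ, if_true]
  ring

/-- **Case 3 residue in closed form**: `(1 − e(k)z)·(1/q)∑_{l<q} T_l(z) → (2/q)R_k(x)` as `z → e(−k)`, `z ≠ e(−k)`, for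
`L(q; 1, x)` with `x` NOT prime to `q`. [cite: BariHunsicker2019, proof of Theorem 3.1, Case 3 (the display after "Substituting")] -/
private theorem tendsto_one_sub_exp_mul_closedForm_o {q : ℕ} [NeZero q] {k x : ℤ} (hk : IsCoprime k q)
    (hx : ¬ IsCoprime x q) (h2 : ¬ (q : ℤ) ∣ 2 * k) :
    Tendsto (fun z : ℂ ↦ (1 - cexp (2 * π * I * k / q) * z) * (1 / (q : ℂ) * ∑ l ∈ range q, (1 - z ^ 2) /
      ((1 - cexp (2 * π * I * l * ((1 : ℤ) : ℂ) / q) * z) * (1 - cexp (-(2 * π * I * l * ((1 : ℤ) : ℂ) / q)) * z) *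
        ((1 - cexp (2 * π * I * l * (x : ℂ) / q) * z) * (1 - cexp (-(2 * π * I * l * (x : ℂ) / q)) * z)))))
      (𝓝[≠] (cexp (2 * π * I * ((-k : ℤ) : ℂ) / q)))
      (𝓝 (2 / (q : ℂ) * (1 / ((1 - cexp (2 * π * I * ((k * (x - 1) : ℤ) : ℂ) / q)) *
        (1 - cexp (2 * π * I * ((-(k * (x + 1)) : ℤ) : ℂ) / q)))))) := by
  have hq : q ≠ 0 := NeZero.ne q
  have h := tendsto_finsetSum (range q) fun l (_ : l ∈ range q) ↦ tendsto_term_o hq hk hx h2 l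
  rw [sum_range_ite_eq_o h2] at h
  have h' := h.const_mul (1 / (q : ℂ))
  rw [show ∀ X : ℂ, 1 / (q : ℂ) * (2 * X) = 2 / (q : ℂ) * X from fun X ↦ by ring] at h'
  refine h'.congr fun z ↦ ?_
  simp only [Finset.mul_sum]
  exact Finset.sum_congr rfl fun l _ ↦ by ring

/-- **Case 4 residue in closed form**: for `L(q; s₁, s₂)` with NEITHER weight prime to `q` and `k` prime to `q`, NO term of (3.8)
has a vanishing factor at `e(−k)` (congruences (1′)–(4′) "have no solutions because `s₁` and `s₂` are not coprime to `q`"), so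
`(1 − e(k)z)·(1/q)∑_{l<q} T_l(z) → 0`. [cite: BariHunsicker2019, proof of Theorem 3.1, Case 4] -/
private theorem tendsto_one_sub_exp_mul_closedForm_zero_o {q : ℕ} [NeZero q] {k s₁ s₂ : ℤ} (hk : IsCoprime k q)
    (hs₁ : ¬ IsCoprime s₁ q) (hs₂ : ¬ IsCoprime s₂ q) :
    Tendsto (fun z : ℂ ↦ (1 - cexp (2 * π * I * k / q) * z) * (1 / (q : ℂ) * ∑ l ∈ range q, (1 - z ^ 2) /
      ((1 - cexp (2 * π * I * l * (s₁ : ℂ) / q) * z) * (1 - cexp (-(2 * π * I * l * (s₁ : ℂ) / q)) * z) *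
        ((1 - cexp (2 * π * I * l * (s₂ : ℂ) / q) * z) * (1 - cexp (-(2 * π * I * l * (s₂ : ℂ) / q)) * z)))))
      (𝓝[≠] (cexp (2 * π * I * ((-k : ℤ) : ℂ) / q))) (𝓝 0) := by
  have hq : q ≠ 0 := NeZero.ne q
  have h := tendsto_finsetSum (range q) fun l (_ : l ∈ range q) ↦
    tendsto_term_zero_o hq (natCast_mul_ne_o hk hs₁ l).1 (natCast_mul_ne_o hk hs₁ l).2 (natCast_mul_ne_o hk hs₂ l).1
      (natCast_mul_ne_o hk hs₂ l).2
  rw [Finset.sum_const_zero] at h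
  have h' := h.const_mul (1 / (q : ℂ))
  rw [mul_zero] at h'
  refine h'.congr fun z ↦ ?_
  simp only [Finset.mul_sum]
  exact Finset.sum_congr rfl fun l _ ↦ by ring

/-! ### §3 The residues of the generating functions of `L(q; 1, x)` (`x` not prime to `q`) and of `L(q; s₁, s₂)` (`s₁, s₂` not
prime to `q`) at the simple pole `e(−k)` -/

/-- **THE RESIDUE OF THE GENERATING FUNCTION OF THE ORBIFOLD LENS SPACE `L(q; 1, x)`, `x` NOT prime to `q`** (Bari–Hunsicker,
proof of Theorem 3.1, Case 3, with `γ` replaced by the root `e(−k)`, `k` prime to `q`, `q ∤ 2k`): the generating function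
`F(z) = ∑_n dim E_{n(n+2)} z^n = (1/q)∑_{l=1}^{q}(1 − z²)/((1 − γ^{l}z)(1 − γ^{−l}z)(1 − γ^{xl}z)(1 − γ^{−xl}z))` ([BariHunsicker2019]
Corollary 2.12 = the tree's `tsum_lensMultiplicity_mul_pow`, valid for arbitrary integer weights) satisfies
`(1 − e(k)z)·F(z) → (2/q)·1/((1 − e(k(x−1)))(1 − e(−k(x+1))))` as `z → e(−k)` inside the unit disc: only the two terms `l ≡ ±k`
contribute ("Congruences (3) and (4) have no solution as `x` is not coprime to `q`. The solution to (1) is `l = q − 1`, and the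
solution to (2) is `l = 1`. … `lim_{z→γ}(z − γ)F₁(z) = −2γ/(q(1 − γ^{−x+1})(1 − γ^{x+1}))`"; for `k = −1` the right side here is
that display divided by `−γ`, the factor between `z − γ` and `1 − γ^{−1}z`). [cite: BariHunsicker2019, Theorem 3.1 (proof, Case 3),
Corollary 2.12, Theorem 2.11] -/
theorem tendsto_one_sub_exp_mul_tsum_lensMultiplicity_of_not_isCoprime {q : ℕ} [NeZero q] {k x : ℤ} (hk : IsCoprime k q)
    (hx : ¬ IsCoprime x q) (h2 : ¬ (q : ℤ) ∣ 2 * k) :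
    Tendsto (fun z : ℂ ↦ (1 - cexp (2 * π * I * k / q) * z) * ∑' n : ℕ, (lensMultiplicity q 1 x n : ℂ) * z ^ n)
      (𝓝[Metric.ball 0 1] (cexp (2 * π * I * ((-k : ℤ) : ℂ) / q)))
      (𝓝 (2 / (q : ℂ) * (1 / ((1 - cexp (2 * π * I * ((k * (x - 1) : ℤ) : ℂ) / q)) *
        (1 - cexp (2 * π * I * ((-(k * (x + 1)) : ℤ) : ℂ) / q)))))) := by
  have hq : q ≠ 0 := NeZero.ne q
  obtain ⟨hle, _⟩ := nhdsWithin_ball_le_and_neBot_o (norm_exp_intCast_o q (-k))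
  refine ((tendsto_one_sub_exp_mul_closedForm_o hk hx h2).mono_left hle).congr' ?_
  filter_upwards [self_mem_nhdsWithin] with z hz
  rw [tsum_lensMultiplicity_mul_pow q hq 1 x (mem_ball_zero_iff.mp hz)]

/-- **THE GENERATING FUNCTION OF `L(q; s₁, s₂)` WITH NEITHER WEIGHT PRIME TO `q` HAS NO POLE AT `e(−k)`, `k` prime to `q`**
(Bari–Hunsicker, proof of Theorem 3.1, Case 4): `(1 − e(k)z)·∑_n dim E_{n(n+2)}(L(q; s₁, s₂)) z^n → 0` as `z → e(−k)` inside
the unit disc ("`lim_{z→γ}(z − γ)F₂(z) = 0` because the congruences … (1′) `s₁l + 1 ≡ 0`, (2′) `−s₁l + 1 ≡ 0`, (3′) `s₂l + 1 ≡ 0`,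
(4′) `−s₂l + 1 ≡ 0 (mod q)` … have no solutions because `s₁` and `s₂` are not coprime to `q`").
[cite: BariHunsicker2019, Theorem 3.1 (proof, Case 4), Corollary 2.12] -/
theorem tendsto_one_sub_exp_mul_tsum_lensMultiplicity_of_not_isCoprime_of_not_isCoprime {q : ℕ} [NeZero q]
    {k s₁ s₂ : ℤ} (hk : IsCoprime k q) (hs₁ : ¬ IsCoprime s₁ q) (hs₂ : ¬ IsCoprime s₂ q) :
    Tendsto (fun z : ℂ ↦ (1 - cexp (2 * π * I * k / q) * z) * ∑' n : ℕ, (lensMultiplicity q s₁ s₂ n : ℂ) * z ^ n)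
      (𝓝[Metric.ball 0 1] (cexp (2 * π * I * ((-k : ℤ) : ℂ) / q))) (𝓝 0) := by
  have hq : q ≠ 0 := NeZero.ne q
  obtain ⟨hle, _⟩ := nhdsWithin_ball_le_and_neBot_o (norm_exp_intCast_o q (-k))
  refine ((tendsto_one_sub_exp_mul_closedForm_zero_o hk hs₁ hs₂).mono_left hle).congr' ?_
  filter_upwards [self_mem_nhdsWithin] with z hz
  rw [tsum_lensMultiplicity_mul_pow q hq s₁ s₂ (mem_ball_zero_iff.mp hz)]

/-- **Two isospectral orbifold lens spaces `L(q; 1, x)`, `L(q; 1, y)` (`x, y` NOT prime to `q`) have the same residues**: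
`1/((1 − e(k(x−1)))(1 − e(−k(x+1)))) = 1/((1 − e(k(y−1)))(1 − e(−k(y+1))))` for every `k` prime to `q` with `q ∤ 2k`
("Since `lim_{z→γ}(z − γ)F₁(z) = lim_{z→γ}(z − γ)F₂(z)`, we get
`−2γ/(q(1 − γ^{−x+1})(1 − γ^{x+1})) = −2γ/(q(1 − γ^{−y+1})(1 − γ^{y+1}))`"). [cite: BariHunsicker2019, Theorem 3.1 (proof, Case 3)] -/
theorem residue_eq_of_lensMultiplicity_eq_of_not_isCoprime {q : ℕ} [NeZero q] {k x y : ℤ} (hk : IsCoprime k q)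
    (hx : ¬ IsCoprime x q) (hy : ¬ IsCoprime y q) (h2 : ¬ (q : ℤ) ∣ 2 * k)
    (h : ∀ n : ℕ, lensMultiplicity q 1 x n = lensMultiplicity q 1 y n) :
    1 / ((1 - cexp (2 * π * I * ((k * (x - 1) : ℤ) : ℂ) / q)) * (1 - cexp (2 * π * I * ((-(k * (x + 1)) : ℤ) : ℂ) / q))) =
      1 / ((1 - cexp (2 * π * I * ((k * (y - 1) : ℤ) : ℂ) / q)) *
        (1 - cexp (2 * π * I * ((-(k * (y + 1)) : ℤ) : ℂ) / q))) := by
  have hq : (q : ℂ) ≠ 0 := Nat.cast_ne_zero.mpr (NeZero.ne q)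
  have t1 := tendsto_one_sub_exp_mul_tsum_lensMultiplicity_of_not_isCoprime hk hx h2
  have t2 := tendsto_one_sub_exp_mul_tsum_lensMultiplicity_of_not_isCoprime hk hy h2
  simp only [h] at t1
  haveI := (nhdsWithin_ball_le_and_neBot_o (norm_exp_intCast_o q (-k))).2
  exact mul_left_cancel₀ (div_ne_zero two_ne_zero hq) (tendsto_nhds_unique t1 t2)

/-! ### §4 THEOREM 3.1, Case 3: `L(q; 1, x)` and `L(q; 1, y)` isospectral, `x, y` not prime to `q` ⟹ `x ≡ ±y (mod q)` -/

/-- The algebra of Case 3: from `1/((1−A)(1−B)) = 1/((1−C)(1−D))` with no factor zero, `AB = CD`, `AW = D`, `CW = B`: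
`(A − C)(1 − W) = 0` ("`(γ^y − γ^x)(1 − γ^{x+y}) = 0`"). [cite: BariHunsicker2019, Theorem 3.1 (proof, Case 3, the chain of
implications)] -/
private theorem eq_or_eq_one_of_one_div_eq_o {A B C D W : ℂ} (hA : 1 - A ≠ 0) (hB : 1 - B ≠ 0) (hC : 1 - C ≠ 0)
    (hD : 1 - D ≠ 0) (hABCD : A * B = C * D) (hAW : A * W = D) (hCW : C * W = B)
    (h : 1 / ((1 - A) * (1 - B)) = 1 / ((1 - C) * (1 - D))) : A = C ∨ W = 1 := by
  rw [div_eq_div_iff (mul_ne_zero hA hB) (mul_ne_zero hC hD), one_mul, one_mul] at h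
  have h0 : (A - C) * (1 - W) = 0 := by linear_combination h + hABCD - hAW + hCW
  rcases mul_eq_zero.mp h0 with h1 | h1
  · exact Or.inl (sub_eq_zero.mp h1)
  · exact Or.inr (sub_eq_zero.mp h1).symm

/-- **Case 3, the congruence extracted from the residues** (general `k` prime to `q`, `q ∤ 2k`): if `L(q; 1, x)` and `L(q; 1, y)`,
`x, y` NOT prime to `q`, are isospectral then `q ∣ k(x − y)` or `q ∣ k(x + y)` ("`⟹ (γ^{−x} + γ^{x}) = (γ^{−y} + γ^{y})` … `⟹
(γ^y − γ^x)(1 − γ^{x+y}) = 0` … `⟹ x ≡ y (mod q)` or `x ≡ −y (mod q)`"). [cite: BariHunsicker2019, Theorem 3.1 (proof, Case 3)] -/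
theorem dvd_mul_sub_or_dvd_mul_add_of_lensMultiplicity_eq_of_not_isCoprime {q : ℕ} [NeZero q] {k x y : ℤ}
    (hk : IsCoprime k q) (hx : ¬ IsCoprime x q) (hy : ¬ IsCoprime y q) (h2 : ¬ (q : ℤ) ∣ 2 * k)
    (h : ∀ n : ℕ, lensMultiplicity q 1 x n = lensMultiplicity q 1 y n) :
    (q : ℤ) ∣ k * (x - y) ∨ (q : ℤ) ∣ k * (x + y) := by
  have hq : q ≠ 0 := NeZero.ne q
  obtain ⟨hmx, hpx⟩ := not_dvd_mul_sub_one_o hk hx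
  obtain ⟨hmy, hpy⟩ := not_dvd_mul_sub_one_o hk hy
  have hr := residue_eq_of_lensMultiplicity_eq_of_not_isCoprime hk hx hy h2 h
  have n1 : ∀ {t : ℤ}, ¬ (q : ℤ) ∣ t → 1 - cexp (2 * π * I * t / q) ≠ 0 := fun ht ↦ by
    rw [sub_ne_zero, ne_comm, Ne, exp_intCast_eq_one_iff_o hq]
    exact ht
  rcases eq_or_eq_one_of_one_div_eq_o (W := cexp (2 * π * I * ((-(k * (x + y))) : ℤ) / q))
      (n1 hmx) (n1 fun h' ↦ hpx (dvd_neg.mp h')) (n1 hmy) (n1 fun h' ↦ hpy (dvd_neg.mp h'))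
      (by rw [exp_intCast_mul_exp_intCast_o, exp_intCast_mul_exp_intCast_o]
          exact exp_intCast_congr_o hq (by push_cast; ring))
      (by rw [exp_intCast_mul_exp_intCast_o]
          exact exp_intCast_congr_o hq (by push_cast; ring))
      (by rw [exp_intCast_mul_exp_intCast_o]
          exact exp_intCast_congr_o hq (by push_cast; ring)) hr with e | e
  · -- `k(x − 1) ≡ k(y − 1)`
    refine Or.inl ((ZMod.intCast_zmod_eq_zero_iff_dvd _ _).mp ?_)
    have e' := (exp_intCast_eq_iff_o hq _ _).mp e
    push_cast at e' ⊢
    linear_combination e'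
  · -- `q ∣ −k(x + y)`
    exact Or.inr (dvd_neg.mp ((exp_intCast_eq_one_iff_o hq _).mp e))

/-- `2` is not prime to `t` iff `2 ∣ t`; used for `q = 2`. [folklore] -/
private theorem two_dvd_of_not_isCoprime_o {t : ℤ} (ht : ¬ IsCoprime t ((2 : ℕ) : ℤ)) : ((2 : ℕ) : ℤ) ∣ t - 0 := by
  rw [sub_zero, Nat.cast_ofNat]
  by_contra hc
  exact ht (by rw [Nat.cast_ofNat]; exact (Int.prime_two.coprime_iff_not_dvd.mpr hc).symm)

/-- **THEOREM 3.1 (Bari–Hunsicker 2019), Case 3, normalized form.** Let `L₁ = L(q : 1, x)` and `L₂ = L(q : 1, y)` be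
three-dimensional orbifold lens spaces with `x` and `y` NOT coprime to `q`. If `L₁` is isospectral to `L₂`
(`dim E_{n(n+2)}` agree for all `n`), then `x ≡ y (mod q)` or `x ≡ −y (mod q)` — hence (Corollary 2.2) `L₁` and `L₂` are
isometric. (For `q ≥ 3` this is the residue computation at `γ`; `q = 2` is trivial — `x, y` are then even — and `q = 1` is
vacuous.) [cite: BariHunsicker2019, Theorem 3.1 (proof, Case 3), Corollary 2.2] -/
theorem dvd_sub_or_dvd_add_of_lensMultiplicity_one_eq_of_not_isCoprime {q : ℕ} [NeZero q] {x y : ℤ}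
    (hx : ¬ IsCoprime x q) (hy : ¬ IsCoprime y q) (h : ∀ n : ℕ, lensMultiplicity q 1 x n = lensMultiplicity q 1 y n) :
    (q : ℤ) ∣ x - y ∨ (q : ℤ) ∣ x + y := by
  have hq : q ≠ 0 := NeZero.ne q
  by_cases h2 : (q : ℤ) ∣ 2
  · -- `q = 1` or `q = 2`
    have hq2 : q ∣ 2 := by exact_mod_cast h2
    have hle : q ≤ 2 := Nat.le_of_dvd two_pos hq2
    have hge : 1 ≤ q := Nat.pos_of_ne_zero hq
    interval_cases q
    · exact absurd (by rw [Nat.cast_one]; exact isCoprime_one_right) hx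
    · have dx := two_dvd_of_not_isCoprime_o hx
      have dy := two_dvd_of_not_isCoprime_o hy
      rw [sub_zero] at dx dy
      exact Or.inl (dvd_sub dx dy)
  · have hk : IsCoprime (1 : ℤ) q := isCoprime_one_left
    have h2' : ¬ (q : ℤ) ∣ 2 * 1 := by rwa [mul_one]
    simpa only [one_mul] using dvd_mul_sub_or_dvd_mul_add_of_lensMultiplicity_eq_of_not_isCoprime hk hx hy h2' h

/-! ### §5 THEOREM 3.1, Case 4: `L(q; 1, x)` (`x` not prime to `q`) and `L(q; s₁, s₂)` (`s₁, s₂` not prime to `q`) are never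
isospectral -/

/-- **THEOREM 3.1 (Bari–Hunsicker 2019), Case 4, normalized form.** Let `L₁ = L(q : 1, x)` with `x` NOT coprime to `q` and
`L₂ = L(q : s₁, s₂)` with NEITHER `s₁` NOR `s₂` coprime to `q`. Then `L₁` is not isospectral to `L₂`: some multiplicity
`dim E_{n(n+2)}` differs ("`lim_{z→γ}(z − γ)F₁(z) = −2γ/(q(1 − γ^{−x+1})(1 − γ^{x+1}))`. However, `lim_{z→γ}(z − γ)F₂(z) = 0` …
Thus, in this case `L₁` cannot be isospectral to `L₂`."; `q = 2` is checked directly at `n = 1`, `q = 1` is vacuous).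
[cite: BariHunsicker2019, Theorem 3.1 (proof, Case 4)] -/
theorem exists_lensMultiplicity_one_ne_of_not_isCoprime {q : ℕ} [NeZero q] {x s₁ s₂ : ℤ} (hx : ¬ IsCoprime x q)
    (hs₁ : ¬ IsCoprime s₁ q) (hs₂ : ¬ IsCoprime s₂ q) :
    ∃ n : ℕ, lensMultiplicity q 1 x n ≠ lensMultiplicity q s₁ s₂ n := by
  have hq : q ≠ 0 := NeZero.ne q
  by_contra! h
  by_cases h2 : (q : ℤ) ∣ 2
  · -- `q = 1` or `q = 2`
    have hq2 : q ∣ 2 := by exact_mod_cast h2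
    have hle : q ≤ 2 := Nat.le_of_dvd two_pos hq2
    have hge : 1 ≤ q := Nat.pos_of_ne_zero hq
    interval_cases q
    · exact hx (by rw [Nat.cast_one]; exact isCoprime_one_right)
    · have e1 := h 1
      rw [lensMultiplicity_congr_right 2 1 (two_dvd_of_not_isCoprime_o hx),
        lensMultiplicity_congr_right 2 s₁ (two_dvd_of_not_isCoprime_o hs₂), lensMultiplicity_swap 2 s₁ 0,
        lensMultiplicity_congr_right 2 0 (two_dvd_of_not_isCoprime_o hs₁)] at e1
      exact absurd e1 (by decide)
  · -- `q ≥ 3`: the residues at `e(−1)` are `(2/q)R₁(x) ≠ 0` and `0`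
    have hqC : (q : ℂ) ≠ 0 := Nat.cast_ne_zero.mpr hq
    have hk : IsCoprime (1 : ℤ) q := isCoprime_one_left
    have h2' : ¬ (q : ℤ) ∣ 2 * 1 := by rwa [mul_one]
    have t1 := tendsto_one_sub_exp_mul_tsum_lensMultiplicity_of_not_isCoprime hk hx h2'
    have t2 := tendsto_one_sub_exp_mul_tsum_lensMultiplicity_of_not_isCoprime_of_not_isCoprime hk hs₁ hs₂
    simp only [h] at t1
    haveI := (nhdsWithin_ball_le_and_neBot_o (norm_exp_intCast_o q (-1))).2
    have e := tendsto_nhds_unique t1 t2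
    obtain ⟨hm, hp⟩ := not_dvd_mul_sub_one_o hk hx
    have n1 : 1 - cexp (2 * π * I * ((1 * (x - 1) : ℤ) : ℂ) / q) ≠ 0 := by
      rw [sub_ne_zero, ne_comm, Ne, exp_intCast_eq_one_iff_o hq]
      exact hm
    have n2 : 1 - cexp (2 * π * I * ((-(1 * (x + 1)) : ℤ) : ℂ) / q) ≠ 0 := by
      rw [sub_ne_zero, ne_comm, Ne, exp_intCast_eq_one_iff_o hq, dvd_neg]
      exact hp
    exact mul_ne_zero (div_ne_zero two_ne_zero hqC) (one_div_ne_zero (mul_ne_zero n1 n2)) e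

/-! ### §6 THEOREM 3.1, Cases 3 and 4, for general weights: Ikeda's / Bari–Hunsicker's isometry criterion -/

/-- `L(q; p₂, p₁) ~ L(q; p₁, p₂)` on the left of Ikeda's criterion. [cite: BariHunsicker2019, Corollary 2.2 ("permuting the
`p_i`'s doesn't change the underlying group")] -/
private theorem lensWeightsEquivalent_swap_left_o {q : ℕ} {p₁ p₂ : ℤ} {s : Fin 2 → ℤ}
    (h : LensWeightsEquivalent q ![p₂, p₁] s) : LensWeightsEquivalent q ![p₁, p₂] s := by
  have e : ((![p₂, p₁] : Fin 2 → ℤ) ∘ (Equiv.swap (0 : Fin 2) 1)) = ![p₁, p₂] := by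
    funext i
    fin_cases i <;> simp [Equiv.swap_apply_left, Equiv.swap_apply_right]
  have h2 := lensWeightsEquivalent_comp_perm q ![p₂, p₁] (Equiv.swap 0 1)
  rw [e] at h2
  exact h2.trans h

/-- `L(q; s₂, s₁) ~ L(q; s₁, s₂)` on the right of Ikeda's criterion. [cite: BariHunsicker2019, Corollary 2.2] -/
private theorem lensWeightsEquivalent_swap_right_o {q : ℕ} {p : Fin 2 → ℤ} {s₁ s₂ : ℤ}
    (h : LensWeightsEquivalent q p ![s₂, s₁]) : LensWeightsEquivalent q p ![s₁, s₂] := by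
  have e : ((![s₁, s₂] : Fin 2 → ℤ) ∘ (Equiv.swap (0 : Fin 2) 1)) = ![s₂, s₁] := by
    funext i
    fin_cases i <;> simp [Equiv.swap_apply_left, Equiv.swap_apply_right]
  have h2 := lensWeightsEquivalent_comp_perm q ![s₁, s₂] (Equiv.swap 0 1)
  rw [e] at h2
  exact h.trans h2

/-- `(u p₁ ≡ 1)` from a Bézout identity, in `ℤ/q`. [folklore] -/
private theorem cast_mul_cast_eq_one_o {q : ℕ} {u p a : ℤ} (hua : u * p + a * q = 1) :
    (u : ZMod q) * (p : ZMod q) = 1 := by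
  have e := congrArg (Int.cast : ℤ → ZMod q) hua
  push_cast at e
  rw [ZMod.natCast_self, mul_zero, add_zero] at e
  exact e

/-- **THEOREM 3.1 (Bari–Hunsicker 2019), Case 3.** Let `L₁ = L(q : p₁, p₂)` and `L₂ = L(q : s₁, s₂)` be three-dimensional
orbifold lens spaces with `p₁`, `s₁` coprime to `q` and `p₂`, `s₂` NOT coprime to `q`. If `L₁` is isospectral to `L₂` then
`L₁` is isometric to `L₂`: Ikeda's criterion `LensWeightsEquivalent q (p₁, p₂) (s₁, s₂)` holds — "(`p₁, p₂)` is a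
permutation of `(e₁ls₁, e₂ls₂) (mod q)`" with `eᵢ = ±1` (and `l` necessarily prime to `q`,
`LensWeightsEquivalent.exists_isCoprime`), the isometry criterion of Corollary 2.2 ("By multiplying the entries of `L₁` and
`L₂` by appropriate numbers coprime to `q` we can rewrite `L₁ = L(q:1, x)` and `L₂ = L(q:1, y)`, where `x` and `y` are not
coprime to `q`. … `x ≡ ±y (mod q)`. Thus, by Corollary 2.2 we get that `L₁` and `L₂` are isometric.").
[cite: BariHunsicker2019, Theorem 3.1 (Case 3), Corollary 2.2] [cite: IkedaYamamoto1979, Proposition 4.1] -/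
theorem lensWeightsEquivalent_of_lensMultiplicity_eq_of_not_isCoprime {q : ℕ} [NeZero q] {p₁ p₂ s₁ s₂ : ℤ}
    (hp₁ : IsCoprime p₁ q) (hp₂ : ¬ IsCoprime p₂ q) (hs₁ : IsCoprime s₁ q) (hs₂ : ¬ IsCoprime s₂ q)
    (h : ∀ n : ℕ, lensMultiplicity q p₁ p₂ n = lensMultiplicity q s₁ s₂ n) :
    LensWeightsEquivalent q ![p₁, p₂] ![s₁, s₂] := by
  obtain ⟨u, a, hua⟩ := hp₁
  obtain ⟨v, b, hvb⟩ := hs₁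
  have hu : (q : ℤ) ∣ u * p₁ - 1 := ⟨-a, by linear_combination hua⟩
  have hv : (q : ℤ) ∣ v * s₁ - 1 := ⟨-b, by linear_combination hvb⟩
  -- the normalized weights `u p₂`, `v s₂` are not coprime to `q`
  have hux : ¬ IsCoprime (u * p₂) q := fun hc ↦ hp₂ hc.of_mul_left_right
  have hvy : ¬ IsCoprime (v * s₂) q := fun hc ↦ hs₂ hc.of_mul_left_right
  have h' : ∀ n : ℕ, lensMultiplicity q 1 (u * p₂) n = lensMultiplicity q 1 (v * s₂) n := fun n ↦ by
    rw [← lensMultiplicity_eq_one_left q hu, ← lensMultiplicity_eq_one_left q hv, h n]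
  have hd := dvd_sub_or_dvd_add_of_lensMultiplicity_one_eq_of_not_isCoprime hux hvy h'
  have huZ := cast_mul_cast_eq_one_o hua
  have hvZ := cast_mul_cast_eq_one_o hvb
  refine (lensWeightsEquivalent_two_iff ⟨v, b, hvb⟩).mpr ?_
  rcases hd with hd | hd
  · -- `u p₂ ≡ v s₂` ⟹ `p₁ s₂ ≡ s₁ p₂`
    refine Or.inl ((ZMod.intCast_zmod_eq_zero_iff_dvd _ _).mp ?_)
    have e := (ZMod.intCast_zmod_eq_zero_iff_dvd _ _).mpr hd
    push_cast at e ⊢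
    linear_combination (-((p₁ : ZMod q) * (s₁ : ZMod q))) * e - (p₁ : ZMod q) * (s₂ : ZMod q) * hvZ +
      (s₁ : ZMod q) * (p₂ : ZMod q) * huZ
  · -- `u p₂ ≡ −v s₂` ⟹ `p₁ s₂ ≡ −s₁ p₂`
    refine Or.inr (Or.inl ((ZMod.intCast_zmod_eq_zero_iff_dvd _ _).mp ?_))
    have e := (ZMod.intCast_zmod_eq_zero_iff_dvd _ _).mpr hd
    push_cast at e ⊢
    linear_combination (p₁ : ZMod q) * (s₁ : ZMod q) * e - (p₁ : ZMod q) * (s₂ : ZMod q) * hvZ -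
      (s₁ : ZMod q) * (p₂ : ZMod q) * huZ

/-- **THEOREM 3.1 (Bari–Hunsicker 2019), Case 3, either order of the weights**: `L₁ = L(q : p₁, p₂)`, `L₂ = L(q : s₁, s₂)`
orbifold lens spaces such that EXACTLY ONE of `p₁, p₂` and EXACTLY ONE of `s₁, s₂` is coprime to `q`; isospectral ⟹
isometric. [cite: BariHunsicker2019, Theorem 3.1 (Case 3), Corollary 2.2] -/
theorem lensWeightsEquivalent_of_lensMultiplicity_eq_of_xor {q : ℕ} [NeZero q] {p₁ p₂ s₁ s₂ : ℤ}
    (hp : Xor (IsCoprime p₁ q) (IsCoprime p₂ q)) (hs : Xor (IsCoprime s₁ q) (IsCoprime s₂ q))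
    (h : ∀ n : ℕ, lensMultiplicity q p₁ p₂ n = lensMultiplicity q s₁ s₂ n) :
    LensWeightsEquivalent q ![p₁, p₂] ![s₁, s₂] := by
  suffices key : ∀ {s₁ s₂ : ℤ}, IsCoprime s₁ q → ¬ IsCoprime s₂ q →
      (∀ n : ℕ, lensMultiplicity q p₁ p₂ n = lensMultiplicity q s₁ s₂ n) → LensWeightsEquivalent q ![p₁, p₂] ![s₁, s₂] by
    rcases hs with ⟨hs₁, hs₂⟩ | ⟨hs₂, hs₁⟩
    · exact key hs₁ hs₂ h
    · exact lensWeightsEquivalent_swap_right_o (key hs₂ hs₁ fun n ↦ (h n).trans (lensMultiplicity_swap q s₁ s₂ n))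
  intro s₁ s₂ hs₁ hs₂ h
  rcases hp with ⟨hp₁, hp₂⟩ | ⟨hp₂, hp₁⟩
  · exact lensWeightsEquivalent_of_lensMultiplicity_eq_of_not_isCoprime hp₁ hp₂ hs₁ hs₂ h
  · exact lensWeightsEquivalent_swap_left_o (lensWeightsEquivalent_of_lensMultiplicity_eq_of_not_isCoprime hp₂ hp₁
      hs₁ hs₂ fun n ↦ (lensMultiplicity_swap q p₂ p₁ n).trans (h n))

/-- **THEOREM 3.1 (Bari–Hunsicker 2019), Case 4**: `L₁ = L(q : p₁, p₂)` with EXACTLY ONE of `p₁, p₂` coprime to `q` and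
`L₂ = L(q : s₁, s₂)` with NEITHER `s₁` NOR `s₂` coprime to `q` are not isospectral ("Thus, in this case `L₁` cannot be
isospectral to `L₂`."). [cite: BariHunsicker2019, Theorem 3.1 (Case 4)] -/
theorem exists_lensMultiplicity_ne_of_not_isCoprime {q : ℕ} [NeZero q] {p₁ p₂ s₁ s₂ : ℤ}
    (hp : Xor (IsCoprime p₁ q) (IsCoprime p₂ q)) (hs₁ : ¬ IsCoprime s₁ q) (hs₂ : ¬ IsCoprime s₂ q) :
    ∃ n : ℕ, lensMultiplicity q p₁ p₂ n ≠ lensMultiplicity q s₁ s₂ n := by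
  suffices key : ∀ {p₁ p₂ : ℤ}, IsCoprime p₁ q → ¬ IsCoprime p₂ q →
      ∃ n : ℕ, lensMultiplicity q p₁ p₂ n ≠ lensMultiplicity q s₁ s₂ n by
    rcases hp with ⟨hp₁, hp₂⟩ | ⟨hp₂, hp₁⟩
    · exact key hp₁ hp₂
    · obtain ⟨n, hn⟩ := key hp₂ hp₁
      exact ⟨n, by rwa [lensMultiplicity_swap q p₁ p₂ n]⟩
  intro p₁ p₂ hp₁ hp₂
  obtain ⟨u, a, hua⟩ := hp₁
  have hu : (q : ℤ) ∣ u * p₁ - 1 := ⟨-a, by linear_combination hua⟩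
  have hux : ¬ IsCoprime (u * p₂) q := fun hc ↦ hp₂ hc.of_mul_left_right
  obtain ⟨n, hn⟩ := exists_lensMultiplicity_one_ne_of_not_isCoprime hux hs₁ hs₂
  exact ⟨n, by rwa [lensMultiplicity_eq_one_left q hu p₂ n]⟩

/-- **THEOREM 3.1 (Bari–Hunsicker 2019) — "Two three-dimensional isospectral orbifold lens spaces are isometric" — for `L₁`
with exactly one weight coprime to `q` (Cases 3 and 4 of the proof).** Let `L₁ = L(q : p₁, p₂)` with EXACTLY ONE of
`p₁, p₂` coprime to `q` (an orbifold lens space with non-trivial isotropy) and let `L₂ = L(q : s₁, s₂)` be an orbifold lens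
space with non-trivial isotropy (`s₁, s₂` not both coprime to `q`). If `L₁` and `L₂` are isospectral then they are
isometric: Ikeda's criterion / Corollary 2.2 `(p₁, p₂) ≡ permutation of (±l s₁, ±l s₂) (mod q)` holds (Case 3), Case 4
(`s₁, s₂` both not coprime) being impossible. Case 1 (both manifolds) is the theorem of Ikeda–Yamamoto and Yamamoto (in the
tree for `q` a prime power, twice a prime power, `q ≤ 10`, and odd `q` with `(p₁ ± p₂, q) = 1`); Case 2 (manifold versus
orbifold) rests on [GR] (isospectral good orbifolds with a common cover have both trivial or both non-trivial singular sets)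
and Case 5 (no weight coprime to `q`) on Proposition 3.2 / Lemma 3.3 of the source — neither is formalised here.
[cite: BariHunsicker2019, Theorem 3.1 (Cases 3, 4), Corollary 2.2] -/
theorem lensWeightsEquivalent_of_lensMultiplicity_eq_orbifold {q : ℕ} [NeZero q] {p₁ p₂ s₁ s₂ : ℤ}
    (hp : Xor (IsCoprime p₁ q) (IsCoprime p₂ q)) (hs : ¬ (IsCoprime s₁ q ∧ IsCoprime s₂ q))
    (h : ∀ n : ℕ, lensMultiplicity q p₁ p₂ n = lensMultiplicity q s₁ s₂ n) :
    LensWeightsEquivalent q ![p₁, p₂] ![s₁, s₂] := by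
  by_cases hs' : Xor (IsCoprime s₁ q) (IsCoprime s₂ q)
  · exact lensWeightsEquivalent_of_lensMultiplicity_eq_of_xor hp hs' h
  · have hiff : (IsCoprime s₁ q ↔ IsCoprime s₂ q) := (not_xor _ _).mp hs'
    have hs₁ : ¬ IsCoprime s₁ q := fun h1 ↦ hs ⟨h1, hiff.mp h1⟩
    have hs₂ : ¬ IsCoprime s₂ q := fun h1 ↦ hs ⟨hiff.mpr h1, h1⟩
    obtain ⟨n, hn⟩ := exists_lensMultiplicity_ne_of_not_isCoprime hp hs₁ hs₂
    exact absurd (h n) hn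

/-- **The multiplier `l` is coprime with `q`** (Corollary 2.2: "there is a number `l` coprime with `q` …"): in Ikeda's
criterion `p_{σ(i)} ≡ e_i l s_i (mod q)`, if SOME weight `p_j` is coprime to `q` then so is `l`. In particular the conclusion
of `lensWeightsEquivalent_of_lensMultiplicity_eq_orbifold` is the isometry criterion of Corollary 2.2 verbatim.
[cite: BariHunsicker2019, Corollary 2.2] [cite: Ikeda1980, Theorem 2.1] -/
theorem LensWeightsEquivalent.exists_isCoprime {n : ℕ} {q : ℕ} {p s : Fin n → ℤ} (h : LensWeightsEquivalent q p s)
    (hp : ∃ j, IsCoprime (p j) q) :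
    ∃ l : ℤ, IsCoprime l q ∧ ∃ e : Fin n → ℤ, (∀ i, e i = 1 ∨ e i = -1) ∧
      ∃ σ : Equiv.Perm (Fin n), ∀ i, p (σ i) ≡ e i * l * s i [ZMOD q] := by
  obtain ⟨l, e, he, σ, hσ⟩ := h
  obtain ⟨j, hj⟩ := hp
  refine ⟨l, ?_, e, he, σ, hσ⟩
  have hj' := hσ (σ.symm j)
  rw [Equiv.apply_symm_apply] at hj'
  obtain ⟨m, hm⟩ := Int.modEq_iff_dvd.mp hj'.symm
  have h1 : IsCoprime (e (σ.symm j) * l * s (σ.symm j)) q := by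
    have e1 : e (σ.symm j) * l * s (σ.symm j) = p j + q * (-m) := by linarith
    rw [e1]
    exact hj.add_mul_left_left (-m)
  exact h1.of_mul_left_left.of_mul_left_right

end Literature.Analysis.InnerProduct
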